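import Summits.HubbardSuperconductivity.HubbardSuperconductivity.Theorems.ThermalWedgeTwSourcedInertnessReduction
import Literature.MathematicalPhysics.QuantumLattice.DWaveSourceFreeGainBound
import Literature.MathematicalPhysics.QuantumLattice.DWaveSourceTorusJointPressureEven
import HarnessLib

/-!
# Route `ThermalWedge`, crux `TwSourcedInertness` (item `stmt-HubbardSuperconductivity-1696`):
# the crux inequality holds UNCONDITIONALLY at every fixed temperature, for small coupling

The crux asks, for every compact `[μ₁,μ₂] ⊂ (-4,0)`, constants `U₀ a C > 0` such that for
`0 < U ≤ U₀`, `1 ≤ β ≤ e^{a/U}`, `μ ∈ [μ₁,μ₂]`, eventually in `L`, for ALL real `h`: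
`p̃_L(β,U,μ,h) − p̃_L(β,U,μ,0) ≤ C(1 + log β)h²`,
`p̃_L(β,U,μ,h) = log Re Z_β(dWaveSourceTorus L U μ h)/(βL²)` (the sourced torus pressure).

THEOREM (`twSourcedInertness_fixedTemperature`, this file, no `sorry`, no hypothesis). For every
compact `[μ₁,μ₂] ⊂ (-4,0)` there is `C > 0` such that for EVERY `β ≥ 1` and `μ ∈ [μ₁,μ₂]` there is a
coupling radius `U₁ = U₁(β,μ) > 0` with, eventually in `L` (threshold depending on `β, μ`), for every
real coupling `|U| ≤ U₁` and EVERY real source `h`: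

  `p̃_L(β,U,μ,h) − p̃_L(β,U,μ,0) ≤ C (1 + log β) h²`.

That is: the Fermi-liquid size `≲ (1 + log β)` of the `d`-wave pair response (nonlinear regime
included) survives the weak repulsion at every FIXED temperature, with `C = C₀ + 1` next to the free
constant `C₀(μ₁,μ₂)` of `dWaveSource_free_sourcedGain_le`; what the crux adds — and what this file does
NOT assert — is a coupling radius uniform down to `T = e^{-a/U}` (`U₁` independent of `β ≤ e^{a/U}`),
i.e. the multiscale expansion of Benfatto–Giuliani–Mastropietro in place of the single-scale one
(engine `(A)` of `Cruxes/TwSourcedInertness/Lines/engine-interface-c2.md`, milestone M1 at fixed `β`).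

Proof. Two regimes in the source at fixed `(β, μ)`, with `δ = δ(β,μ)`, `K = K(β,μ)` of the mixed-increment
bound `|log Z_L(U,h) − log Z_L(U,0) − log Z_L(0,h) + log Z_L(0,0)| ≤ K L²|U|h²` (`|U|,|h| ≤ δ`, `L ≥ 3`;
`dWaveSourceTorus_log_partitionFn_mixed_increment_le_sq`, p129311) and `U₁ := min(δ²/2, δ, 1/(K+1))`:
* `|h| ≤ δ`: the mixed increment gives `gain_U(h) ≤ gain_0(h) + K|U|h²/β ≤ C₀(1+log β)h² + h²`;
* `|h| > δ`: `gain_U(h) ≤ gain_0(h) + 2|U|` (`sourcedGain_le_free_add`, `|p̃_U − p̃_0| ≤ |U|`) and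
  `2|U| ≤ δ² < h²`.
In both cases the free gain is `≤ C₀(1+log β)h²` for all `h` (`dWaveSource_free_sourcedGain_le`, p77193-class
free certificate), and `h² ≤ (1 + log β)h²`. Threshold `L₀ = max(L₀^{free}(β,μ), 3)`.

Sources: G. Benfatto, A. Giuliani, V. Mastropietro, Ann. Henri Poincaré 7 (2006) 809–898, §2 (2.77)
(single-scale bound); M. Salmhofer, *Renormalization* (1999) §4.5.4 (Cooper logarithm). Tree:
`ThermalWedgeTwSourcedInertnessReduction`, `Literature/…/DWaveSourceFreeGainBound`,
`Literature/…/DWaveSourceTorusJointPressureEven`. No definition, no named fact.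
-/

noncomputable section

namespace Summit.HubbardSuperconductivity.HubbardSuperconductivity.Theorems

open Matrix Finset Literature.MathematicalPhysics.QuantumLattice

/-- **`TwSourcedInertness` at fixed temperature.** For every compact `[μ₁,μ₂] ⊂ (-4,0)` there is
`C > 0` such that for every `β ≥ 1`, `μ ∈ [μ₁,μ₂]` there is `U₁ > 0` with, eventually in `L`, for all
real `U`, `h` with `|U| ≤ U₁`: `p̃_L(β,U,μ,h) − p̃_L(β,U,μ,0) ≤ C(1 + log β)h²`.
Free gain bound plus the single-scale mixed-increment bound (p129311) on `|h| ≤ δ(β,μ)`, and the crude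
slack `2|U| ≤ δ² < h²` beyond. [cite: BenfattoGiulianiMastropietro2006, (2.77)] -/
theorem twSourcedInertness_fixedTemperature :
    ∀ μ₁ μ₂ : ℝ, -4 < μ₁ → μ₁ ≤ μ₂ → μ₂ < 0 → ∃ C : ℝ, 0 < C ∧
      ∀ β : ℝ, 1 ≤ β → ∀ μ ∈ Set.Icc μ₁ μ₂, ∃ U₁ : ℝ, 0 < U₁ ∧ ∃ L₀ : ℕ, ∀ (L : ℕ) [NeZero L],
        L₀ ≤ L → ∀ U h : ℝ, |U| ≤ U₁ →
          Real.log (Matrix.partitionFn β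
              (Literature.MathematicalPhysics.QuantumLattice.dWaveSourceTorus L U μ h)).re /
              (β * (L : ℝ) ^ 2) -
            Real.log (Matrix.partitionFn β
              (Literature.MathematicalPhysics.QuantumLattice.dWaveSourceTorus L U μ 0)).re /
              (β * (L : ℝ) ^ 2) ≤
          C * (1 + Real.log β) * h ^ 2 := by
  classical
  intro μ₁ μ₂ h4 h12 h0
  obtain ⟨C₀, hC₀, hFree⟩ := dWaveSource_free_sourcedGain_le μ₁ μ₂ h4 h12 h0
  refine ⟨C₀ + 1, by linarith, ?_⟩
  intro β hβ μ hμ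
  have hβ0 : 0 < β := by linarith
  obtain ⟨δ, hδ, K, hK, hmix⟩ :=
    dWaveSourceTorus_log_partitionFn_mixed_increment_le_sq β μ hβ0.le
  obtain ⟨L₁, hL₁⟩ := hFree β hβ μ hμ
  refine ⟨min (δ ^ 2 / 2) (min δ (1 / (K + 1))), by positivity, max L₁ 3, ?_⟩
  intro L _ hL U h hU
  have hL₁L : L₁ ≤ L := le_of_max_le_left hL
  have hL3 : 3 ≤ L := le_of_max_le_right hL
  have hsq : 0 ≤ h ^ 2 := sq_nonneg h
  have hlogβ : 0 ≤ Real.log β := Real.log_nonneg hβ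
  have hUδ2 : |U| ≤ δ ^ 2 / 2 := hU.trans (min_le_left _ _)
  have hUδ : |U| ≤ δ := hU.trans ((min_le_right _ _).trans (min_le_left _ _))
  have hUK : |U| ≤ 1 / (K + 1) := hU.trans ((min_le_right _ _).trans (min_le_right _ _))
  -- the free gain at this `h`
  have hfree := hL₁ L hL₁L h
  -- `h² ≤ (1 + log β) h²`, so it suffices to bound the gain by the free gain plus `h²`
  have hgoal : ∀ G : ℝ, G ≤ C₀ * (1 + Real.log β) * h ^ 2 + h ^ 2 →
      G ≤ (C₀ + 1) * (1 + Real.log β) * h ^ 2 := by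
    intro G hG
    have : h ^ 2 ≤ (1 + Real.log β) * h ^ 2 := by nlinarith
    nlinarith
  apply hgoal
  rcases le_or_gt |h| δ with hsmall | hlarge
  · -- `|h| ≤ δ`: the single-scale mixed increment (instance arguments bridged by `convert`)
    have hm0 : |Real.log (Matrix.partitionFn β (dWaveSourceTorus L U μ h)).re -
          Real.log (Matrix.partitionFn β (dWaveSourceTorus L U μ 0)).re -
          Real.log (Matrix.partitionFn β (dWaveSourceTorus L 0 μ h)).re +
          Real.log (Matrix.partitionFn β (dWaveSourceTorus L 0 μ 0)).re| ≤
        K * (L : ℝ) ^ 2 * |U| * h ^ 2 := by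
      convert hmix L hL3 U h hUδ hsmall
    have hm := abs_le.mp hm0
    have hLpos : (0 : ℝ) < L := by exact_mod_cast Nat.pos_of_ne_zero (NeZero.ne L)
    have hβL : 0 < β * (L : ℝ) ^ 2 := by positivity
    have hKU : K * |U| ≤ 1 := by
      have h1 : |U| * (K + 1) ≤ 1 := by
        have := hUK
        rwa [le_div_iff₀ (by positivity)] at this
      nlinarith [abs_nonneg U]
    have hslack : K * (L : ℝ) ^ 2 * |U| * h ^ 2 ≤ β * (L : ℝ) ^ 2 * h ^ 2 := by
      have hL2h : 0 ≤ (L : ℝ) ^ 2 * h ^ 2 := by positivity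
      calc K * (L : ℝ) ^ 2 * |U| * h ^ 2 = (K * |U|) * ((L : ℝ) ^ 2 * h ^ 2) := by ring
        _ ≤ 1 * ((L : ℝ) ^ 2 * h ^ 2) := mul_le_mul_of_nonneg_right hKU hL2h
        _ ≤ β * ((L : ℝ) ^ 2 * h ^ 2) := mul_le_mul_of_nonneg_right hβ hL2h
        _ = β * (L : ℝ) ^ 2 * h ^ 2 := by ring
    rw [← sub_div] at hfree ⊢
    rw [div_le_iff₀ hβL] at hfree ⊢
    have hring : (C₀ * (1 + Real.log β) * h ^ 2 + h ^ 2) * (β * (L : ℝ) ^ 2) =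
        C₀ * (1 + Real.log β) * h ^ 2 * (β * (L : ℝ) ^ 2) + β * (L : ℝ) ^ 2 * h ^ 2 := by ring
    rw [hring]
    linarith [hm.1, hm.2, hfree, hslack]
  · -- `|h| > δ`: crude slack `2|U| ≤ δ² < h²`
    have hcomp := sourcedGain_le_free_add L U μ h hβ0
    have hδh : δ ^ 2 < h ^ 2 := by
      have := sq_lt_sq' (by linarith [abs_nonneg h, hδ]) hlarge
      simpa [sq_abs] using this
    have h2U : 2 * |U| ≤ h ^ 2 := by linarith
    linarith

end Summit.HubbardSuperconductivity.HubbardSuperconductivity.Theorems
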